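import Literature.Analysis.Calculus.JointSmoothnessPartials
import Summits.AnomalousDissipation.AnomalousDissipation.Theorems.BaireTransferDenseLoudDesignerForcesErgodicLine

/-!
# Joint `C²` of a two-parameter family from its partial-derivative fields (registered tools stub S4b of the crux
# `DenseLoudDesignerForces`, line ergodic-budget-selection-closing, block N-R)

Pure calculus over `Literature.Analysis.Calculus.contDiffOn_succ_of_partial` (joint `C^{n+1}` on an open subset of a
product from `HasFDerivAt` partial-derivative fields that are `Cⁿ`), applied twice on the open set
`Ioo 0 3 ×ˢ U ⊆ ℝ × E`: the partial fields of `(t, y) ↦ g t y` are the time derivative `deriv (g · y) t` and the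
space derivative `fderiv (g t ·) y`; each of them is `C¹` because ITS two partial fields exist and are continuous.  This
is the shape in which block N-R supplies the field `contDiffOn` of `IsHyperbolicSemiflowModel` (the analytic inputs —
existence and joint continuity of the second-order fields — are the registered stubs S6c₁, S6c₂ and T6).
-/

set_option linter.dupNamespace false

noncomputable section

open Set Function Filter
open scoped Topology ContDiff

namespace Summit.AnomalousDissipation.AnomalousDissipation.Theorems.DenseLoudDesignerForces.Ergodic

open Literature.Analysis.Calculus

section Generic

variable {E : Type*} [NormedAddCommGroup E] [NormedSpace ℝ E]

/-- A vector field `v` gives the field of rank-one operators `smulRight 1 (v q)`, and `Cⁿ` is preserved. [folklore] -/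
theorem contDiffOn_smulRight_one {G : Type*} [NormedAddCommGroup G] [NormedSpace ℝ G] {X : Type*} [NormedAddCommGroup X]
    [NormedSpace ℝ X] {v : X → G} {O : Set X} {n : WithTop ℕ∞} (hv : ContDiffOn ℝ n v O) :
    ContDiffOn ℝ n (fun q => (ContinuousLinearMap.smulRight (1 : ℝ →L[ℝ] ℝ) (v q) : ℝ →L[ℝ] G)) O :=
  contDiffOn_const.smulRight hv

/-- **Joint `C²` from partial-derivative fields** (generic normed space): on the open set `Ioo 0 3 ×ˢ U`, if `y ↦ g t y` is smooth for
each `t ∈ [0,3]`, the orbits are twice differentiable in `t` with continuous second time-derivative field, the time-derivative field is Fréchet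
differentiable in `y` with derivative the (continuous) mixed field `deriv (fderiv (g · ·) y) t`, the operator field `fderiv (g t ·) y` is differentiable
in `t` with that same derivative, and the second space derivative is continuous, then `(t,y) ↦ g t y` is jointly `C²`
(`contDiffOn_succ_of_partial` twice). [folklore] -/
theorem contDiffOn_two_of_partialFields {g : ℝ → E → E} {U : Set E} (hU : IsOpen U)
    (hsmooth : ∀ t ∈ Icc (0 : ℝ) 3, ContDiffOn ℝ ∞ (fun y => g t y) U)
    (h₁ : ∀ q ∈ Ioo (0 : ℝ) 3 ×ˢ U, HasDerivAt (fun t => g t q.2) (deriv (fun t => g t q.2) q.1) q.1)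
    (h₁₁ : ∀ q ∈ Ioo (0 : ℝ) 3 ×ˢ U, HasDerivAt (fun t => deriv (fun s => g s q.2) t) (deriv (fun t => deriv (fun s => g s q.2) t) q.1) q.1)
    (hc₁₁ : ContinuousOn (fun q : ℝ × E => deriv (fun t => deriv (fun s => g s q.2) t) q.1) (Ioo (0 : ℝ) 3 ×ˢ U))
    (h₂₁ : ∀ q ∈ Ioo (0 : ℝ) 3 ×ˢ U, HasDerivAt (fun t => fderiv ℝ (fun y => g t y) q.2) (deriv (fun t => fderiv ℝ (fun y => g t y) q.2) q.1) q.1)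
    (h₁₂ : ∀ q ∈ Ioo (0 : ℝ) 3 ×ˢ U, HasFDerivAt (fun y => deriv (fun t => g t y) q.1) (deriv (fun t => fderiv ℝ (fun y => g t y) q.2) q.1) q.2)
    (hc₁₂ : ContinuousOn (fun q : ℝ × E => deriv (fun t => fderiv ℝ (fun y => g t y) q.2) q.1) (Ioo (0 : ℝ) 3 ×ˢ U))
    (hc₂₂ : ContinuousOn (fun q : ℝ × E => fderiv ℝ (fun y => fderiv ℝ (fun y' => g q.1 y') y) q.2) (Ioo (0 : ℝ) 3 ×ˢ U)) :
    ContDiffOn ℝ 2 (fun q : ℝ × E => g q.1 q.2) (Ioo (0 : ℝ) 3 ×ˢ U) := by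
  have hO : IsOpen (Ioo (0 : ℝ) 3 ×ˢ U) := isOpen_Ioo.prod hU
  have hsm : ∀ q ∈ Ioo (0 : ℝ) 3 ×ˢ U, ContDiffAt ℝ ∞ (fun y => g q.1 y) q.2 := fun q hq =>
    (hsmooth q.1 (Ioo_subset_Icc_self hq.1)).contDiffAt (hU.mem_nhds hq.2)
  -- `f₁ := smulRight 1 (deriv (g · y) t)` is `C¹`
  have hv : ContDiffOn ℝ 1 (fun q : ℝ × E => deriv (fun t => g t q.2) q.1) (Ioo (0 : ℝ) 3 ×ˢ U) := by
    have h := contDiffOn_succ_of_partial (n := 0) (f := fun q : ℝ × E => deriv (fun t => g t q.2) q.1) hO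
      (f₁ := fun q => ContinuousLinearMap.smulRight (1 : ℝ →L[ℝ] ℝ) (deriv (fun t => deriv (fun s => g s q.2) t) q.1))
      (f₂ := fun q => deriv (fun t => fderiv ℝ (fun y => g t y) q.2) q.1)
      (fun q hq => (h₁₁ q hq).hasFDerivAt) (fun q hq => h₁₂ q hq)
      (contDiffOn_smulRight_one (contDiffOn_zero.2 hc₁₁)) (contDiffOn_zero.2 hc₁₂)
    exact_mod_cast h
  have hc₁ : ContDiffOn ℝ 1 (fun q : ℝ × E => ContinuousLinearMap.smulRight (1 : ℝ →L[ℝ] ℝ) (deriv (fun t => g t q.2) q.1))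
      (Ioo (0 : ℝ) 3 ×ˢ U) := contDiffOn_smulRight_one hv
  -- `f₂ := fderiv (g t ·) y` is `C¹`
  have hc₂ : ContDiffOn ℝ 1 (fun q : ℝ × E => fderiv ℝ (fun y => g q.1 y) q.2) (Ioo (0 : ℝ) 3 ×ˢ U) := by
    have h := contDiffOn_succ_of_partial (n := 0) (f := fun q : ℝ × E => fderiv ℝ (fun y => g q.1 y) q.2) hO
      (f₁ := fun q => ContinuousLinearMap.smulRight (1 : ℝ →L[ℝ] ℝ) (deriv (fun t => fderiv ℝ (fun y => g t y) q.2) q.1))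
      (f₂ := fun q => fderiv ℝ (fun y => fderiv ℝ (fun y' => g q.1 y') y) q.2)
      (fun q hq => (h₂₁ q hq).hasFDerivAt)
      (fun q hq => by
        have hd : ContDiffAt ℝ ∞ (fun y => fderiv ℝ (fun y' => g q.1 y') y) q.2 :=
          (hsm q hq).fderiv_right (m := ∞) (by simp)
        exact (hd.differentiableAt (by simp)).hasFDerivAt)
      (contDiffOn_smulRight_one (contDiffOn_zero.2 hc₁₂)) (contDiffOn_zero.2 hc₂₂)
    exact_mod_cast h
  have h := contDiffOn_succ_of_partial (n := 1) (f := fun q : ℝ × E => g q.1 q.2) hO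
    (f₁ := fun q => ContinuousLinearMap.smulRight (1 : ℝ →L[ℝ] ℝ) (deriv (fun t => g t q.2) q.1))
    (f₂ := fun q => fderiv ℝ (fun y => g q.1 y) q.2)
    (fun q hq => (h₁ q hq).hasFDerivAt) (fun q hq => ((hsm q hq).differentiableAt (by simp)).hasFDerivAt) hc₁ hc₂
  exact_mod_cast h

end Generic

/-- **Joint `C²` of the model map from its partial-derivative fields** (registered tools stub S4b; the `Hsp` instance of
`contDiffOn_two_of_partialFields`). [folklore] -/
theorem stub_jointSmoothnessTools {g : ℝ → Hsp → Hsp} {U : Set Hsp} (hU : IsOpen U)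
    (hsmooth : ∀ t ∈ Icc (0 : ℝ) 3, ContDiffOn ℝ ∞ (fun y => g t y) U)
    (h₁ : ∀ q ∈ Ioo (0 : ℝ) 3 ×ˢ U, HasDerivAt (fun t => g t q.2) (deriv (fun t => g t q.2) q.1) q.1)
    (h₁₁ : ∀ q ∈ Ioo (0 : ℝ) 3 ×ˢ U, HasDerivAt (fun t => deriv (fun s => g s q.2) t) (deriv (fun t => deriv (fun s => g s q.2) t) q.1) q.1)
    (hc₁₁ : ContinuousOn (fun q : ℝ × Hsp => deriv (fun t => deriv (fun s => g s q.2) t) q.1) (Ioo (0 : ℝ) 3 ×ˢ U))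
    (h₂₁ : ∀ q ∈ Ioo (0 : ℝ) 3 ×ˢ U, HasDerivAt (fun t => fderiv ℝ (fun y => g t y) q.2) (deriv (fun t => fderiv ℝ (fun y => g t y) q.2) q.1) q.1)
    (h₁₂ : ∀ q ∈ Ioo (0 : ℝ) 3 ×ˢ U, HasFDerivAt (fun y => deriv (fun t => g t y) q.1) (deriv (fun t => fderiv ℝ (fun y => g t y) q.2) q.1) q.2)
    (hc₁₂ : ContinuousOn (fun q : ℝ × Hsp => deriv (fun t => fderiv ℝ (fun y => g t y) q.2) q.1) (Ioo (0 : ℝ) 3 ×ˢ U))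
    (hc₂₂ : ContinuousOn (fun q : ℝ × Hsp => fderiv ℝ (fun y => fderiv ℝ (fun y' => g q.1 y') y) q.2) (Ioo (0 : ℝ) 3 ×ˢ U)) :
    ContDiffOn ℝ 2 (fun q : ℝ × Hsp => g q.1 q.2) (Ioo (0 : ℝ) 3 ×ˢ U) :=
  contDiffOn_two_of_partialFields hU hsmooth h₁ h₁₁ hc₁₁ h₂₁ h₁₂ hc₁₂ hc₂₂

end Summit.AnomalousDissipation.AnomalousDissipation.Theorems.DenseLoudDesignerForces.Ergodic

end
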